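import Literature.Analysis.PDE.Wave1DFarModelComparison
import HarnessLib

/-!
# Far-cone comparison with a model wave at apex `0`: both time directions and the `liminf` form

Analysis/PDE support file (everything proved, no definitions), companion of
`Wave1DFarModelComparison.lean` (same hypotheses: `V, V₀ ≥ 0` continuous and close far out,
`(V₀ − V)² ≤ D²x⁻³V`, `(1−κ)V₀ ≤ V` for `x ≥ X`; `ψ` a global `C²` solution of the `V`-equation of
energy `≤ E` vanishing on `{x + |t| < R₀}`, `R₀ ≥ 2X`; `φ` a global `C²` solution of the
`V₀`-equation on the closed cone `{|t| ≤ x}` with the data of `ψ` on `x > 0`):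

* `far_model_comparison_backward` — for `t ≤ 0`,
  `∫⁻_{x>−t} e_{V₀}[φ](t) ≤ (2/(1−κ)) ∫⁻_{x>−t} e_V[ψ](t) + 512 D² E/R₀` (time reversal `t ↦ −t`
  preserves every hypothesis);
* `far_model_comparison_liminf_atTop` / `…_atBot` — the same inequality between the `liminf`s of
  `t ↦ ∫⁻_{x>|t|} e(t)` at `±∞` (an increasing affine map of `[0,∞]` with finite slope commutes with
  `liminf`, `liminf_const_mul_add`).
Transfer step of the per-mode far-side half-share of crux `WindowedShellChannels`
(route PhotonSphereChannels, stmt-FinalStateConjecture-14085, stub `stub_farHalfShare`). Folklore.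
-/

noncomputable section

namespace Literature.Analysis.PDE

open MeasureTheory Set Filter Topology intervalIntegral Real Literature.Analysis.Calculus
open scoped ENNReal

variable {V V₀ : ℝ → ℝ} {ψ φ : ℝ → ℝ → ℝ}

/-! ### Both time directions and the `liminf` form -/

/-- An affine increasing map of `[0,∞]` with finite slope commutes with `liminf`. [folklore] -/
theorem liminf_const_mul_add {l : Filter ℝ} [l.NeBot] (a b : ℝ≥0∞) (ha : a ≠ ⊤) (u : ℝ → ℝ≥0∞) :
    liminf (fun t => a * u t + b) l = a * liminf u l + b := by
  have hmono : Monotone fun y : ℝ≥0∞ => a * y + b := fun y z h => by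
    show a * y + b ≤ a * z + b
    gcongr
  have hcont : Continuous fun y : ℝ≥0∞ => a * y + b :=
    (ENNReal.continuous_const_mul ha).add continuous_const
  exact (hmono.map_liminf_of_continuousAt u hcont.continuousAt).symm

section TwoSided

variable (hV : Continuous V) (hV0 : ∀ x, 0 ≤ V x) (hV₀ : Continuous V₀) (hV₀0 : ∀ x, 0 ≤ V₀ x)
  (hψ : ContDiff ℝ 2 (Function.uncurry ψ))
  (hψsol : ∀ t x, iteratedDeriv 2 (fun τ => ψ τ x) t - iteratedDeriv 2 (ψ t) x + V x * ψ t x = 0)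
  (hφ : ContDiff ℝ 2 (Function.uncurry φ))
  (hφsol : ∀ t x, |t| ≤ x →
    iteratedDeriv 2 (fun τ => φ τ x) t - iteratedDeriv 2 (φ t) x + V₀ x * φ t x = 0)
  {X R₀ D κ E : ℝ} (hX : 0 < X) (hXR : 2 * X ≤ R₀) (hD : 0 ≤ D) (hκ0 : 0 ≤ κ) (hκ1 : κ < 1)
  (hE : 0 ≤ E)
  (hclose : ∀ x, X ≤ x → (V₀ x - V x) ^ 2 ≤ D ^ 2 * x ^ (-(3 : ℝ)) * V x)
  (hlow : ∀ x, X ≤ x → (1 - κ) * V₀ x ≤ V x)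
  (hvan : ∀ t x, x + |t| < R₀ → ψ t x = 0)
  (hdat : ∀ x, 0 < x → φ 0 x = ψ 0 x ∧ deriv (fun τ => φ τ x) 0 = deriv (fun τ => ψ τ x) 0)
  (hEψ : ∀ τ, ∫⁻ x, ENNReal.ofReal
    (deriv (fun s => ψ s x) τ ^ 2 + deriv (ψ τ) x ^ 2 + V x * ψ τ x ^ 2) ≤ ENNReal.ofReal E)
include hV hV0 hV₀ hV₀0 hψ hψsol hφ hφsol hX hXR hD hκ0 hκ1 hE hclose hlow hvan hdat hEψ

/-- **Far-cone comparison at apex `0`, backward in time.** For every `t ≤ 0`,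
`∫⁻_{x>−t} e_{V₀}[φ](t) ≤ (2/(1−κ)) ∫⁻_{x>−t} e_V[ψ](t) + 512 D² E / R₀` (time reversal).
[folklore] -/
theorem far_model_comparison_backward {t : ℝ} (ht : t ≤ 0) :
    ∫⁻ x in Ioi (-t), ENNReal.ofReal
        (deriv (fun τ => φ τ x) t ^ 2 + deriv (φ t) x ^ 2 + V₀ x * φ t x ^ 2)
      ≤ ENNReal.ofReal (2 / (1 - κ)) * (∫⁻ x in Ioi (-t), ENNReal.ofReal
          (deriv (fun τ => ψ τ x) t ^ 2 + deriv (ψ t) x ^ 2 + V x * ψ t x ^ 2))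
        + ENNReal.ofReal (512 * D ^ 2 * E / R₀) := by
  -- the reversed functions
  obtain ⟨hψ', hψsol', heψ'⟩ := wave1D_timeReversal hψ hψsol
  set Fφ : ℝ → ℝ → ℝ := fun t x =>
    iteratedDeriv 2 (fun τ => φ τ x) t - iteratedDeriv 2 (φ t) x + V₀ x * φ t x with hFφ
  obtain ⟨hφ', hφsol', heφ'⟩ := wave1D_timeReversal_source (F := Fφ) hφ (fun t x => rfl)
  have hφsol'' : ∀ t x, |t| ≤ x →
      iteratedDeriv 2 (fun τ => (fun t x => φ (-t) x) τ x) t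
        - iteratedDeriv 2 ((fun t x => φ (-t) x) t) x + V₀ x * (fun t x => φ (-t) x) t x = 0 := by
    intro t x hx
    rw [hφsol' t x]
    exact hφsol (-t) x (by rwa [abs_neg])
  have hvan' : ∀ t x, x + |t| < R₀ → (fun t x => ψ (-t) x) t x = 0 := by
    intro t x hx
    exact hvan (-t) x (by rwa [abs_neg])
  have hdψ : ∀ x, DifferentiableAt ℝ (fun τ => ψ τ x) 0 :=
    fun x => (contDiff_two_slices' hψ 0 x).1.differentiable (by norm_num) 0
  have hdφ : ∀ x, DifferentiableAt ℝ (fun τ => φ τ x) 0 :=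
    fun x => (contDiff_two_slices' hφ 0 x).1.differentiable (by norm_num) 0
  have hdat' : ∀ x, 0 < x → (fun t x => φ (-t) x) 0 x = (fun t x => ψ (-t) x) 0 x ∧
      deriv (fun τ => (fun t x => φ (-t) x) τ x) 0 = deriv (fun τ => (fun t x => ψ (-t) x) τ x) 0 := by
    intro x hx
    obtain ⟨h1, h2⟩ := hdat x hx
    refine ⟨by simpa using h1, ?_⟩
    show deriv (fun τ => φ (-τ) x) 0 = deriv (fun τ => ψ (-τ) x) 0
    rw [deriv_comp_neg (fun τ => φ τ x) 0, deriv_comp_neg (fun τ => ψ τ x) 0, neg_zero, h2]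
  have hEψ' : ∀ τ, ∫⁻ x, ENNReal.ofReal
      (deriv (fun s => (fun t x => ψ (-t) x) s x) τ ^ 2 + deriv ((fun t x => ψ (-t) x) τ) x ^ 2
        + V x * (fun t x => ψ (-t) x) τ x ^ 2) ≤ ENNReal.ofReal E := by
    intro τ
    have h := hEψ (-τ)
    refine le_of_eq_of_le (lintegral_congr fun x => ?_) h
    rw [heψ' τ x]
  have h := far_model_comparison_forward hV hV0 hV₀ hV₀0 hψ' hψsol' hφ' hφsol'' hX hXR hD hE hclose
    hvan' hdat' hEψ' hκ0 hκ1 hlow (t := -t) (by linarith)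
  have e1 : ∀ x, deriv (fun τ => (fun t x => φ (-t) x) τ x) (-t) ^ 2
      + deriv ((fun t x => φ (-t) x) (-t)) x ^ 2 + V₀ x * (fun t x => φ (-t) x) (-t) x ^ 2
      = deriv (fun τ => φ τ x) t ^ 2 + deriv (φ t) x ^ 2 + V₀ x * φ t x ^ 2 := by
    intro x
    rw [heφ' (-t) x]; simp
  have e2 : ∀ x, deriv (fun τ => (fun t x => ψ (-t) x) τ x) (-t) ^ 2
      + deriv ((fun t x => ψ (-t) x) (-t)) x ^ 2 + V x * (fun t x => ψ (-t) x) (-t) x ^ 2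
      = deriv (fun τ => ψ τ x) t ^ 2 + deriv (ψ t) x ^ 2 + V x * ψ t x ^ 2 := by
    intro x
    rw [heψ' (-t) x]; simp
  simp only [e1, e2] at h
  exact h

/-- **`liminf` form, `t → +∞`.** [folklore] -/
theorem far_model_comparison_liminf_atTop :
    liminf (fun t => ∫⁻ x in Ioi |t|, ENNReal.ofReal
        (deriv (fun τ => φ τ x) t ^ 2 + deriv (φ t) x ^ 2 + V₀ x * φ t x ^ 2)) atTop
      ≤ ENNReal.ofReal (2 / (1 - κ)) * liminf (fun t => ∫⁻ x in Ioi |t|, ENNReal.ofReal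
          (deriv (fun τ => ψ τ x) t ^ 2 + deriv (ψ t) x ^ 2 + V x * ψ t x ^ 2)) atTop
        + ENNReal.ofReal (512 * D ^ 2 * E / R₀) := by
  rw [← liminf_const_mul_add _ _ ENNReal.ofReal_ne_top]
  refine liminf_le_liminf ?_
  filter_upwards [eventually_ge_atTop (0 : ℝ)] with t ht
  rw [abs_of_nonneg ht]
  exact far_model_comparison_forward hV hV0 hV₀ hV₀0 hψ hψsol hφ hφsol hX hXR hD hE hclose hvan hdat
    hEψ hκ0 hκ1 hlow ht

/-- **`liminf` form, `t → −∞`.** [folklore] -/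
theorem far_model_comparison_liminf_atBot :
    liminf (fun t => ∫⁻ x in Ioi |t|, ENNReal.ofReal
        (deriv (fun τ => φ τ x) t ^ 2 + deriv (φ t) x ^ 2 + V₀ x * φ t x ^ 2)) atBot
      ≤ ENNReal.ofReal (2 / (1 - κ)) * liminf (fun t => ∫⁻ x in Ioi |t|, ENNReal.ofReal
          (deriv (fun τ => ψ τ x) t ^ 2 + deriv (ψ t) x ^ 2 + V x * ψ t x ^ 2)) atBot
        + ENNReal.ofReal (512 * D ^ 2 * E / R₀) := by
  rw [← liminf_const_mul_add _ _ ENNReal.ofReal_ne_top]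
  refine liminf_le_liminf ?_
  filter_upwards [eventually_le_atBot (0 : ℝ)] with t ht
  rw [abs_of_nonpos ht]
  exact far_model_comparison_backward hV hV0 hV₀ hV₀0 hψ hψsol hφ hφsol hX hXR hD hκ0 hκ1 hE hclose
    hlow hvan hdat hEψ ht

end TwoSided


end Literature.Analysis.PDE
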